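/-
COR-CM (cell pub-hodgecm2, stage 2 of the Hodge ladder) — count-neutral kernel combinatorics (seat prover-pub-hodgecm2-b23-g51-0, binder
prover b23, gen 51; lane SYLOW TRANSFER, claim HOME/INBOX.md l.23329; blanket `Census/SylowTransfer*` l.23357).  Theorems only, in seat b09's
intrinsic model (consumed BY NAME, nothing restated); no definition, no certificate, no `decide`, no named fact, no geometry, no `sorry`.
`Interfaces.lean` (C1), every E term, B01 and `Transposition/*` are untouched.
HONEST FRAMING: `HC_CM` is NOT proved, here or anywhere in the tree; nothing here is a period or a headline.
-/
import Summits.HodgeConjecture.CorCM.Census.SylowTransferEightOdd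
import Summits.HodgeConjecture.CorCM.Census.IndexTwoCyclicInversion
import Summits.HodgeConjecture.CorCM.Census.OcticProductCyclic
import Summits.HodgeConjecture.CorCM.Census.OcticProductExhaust

/-!
# Sylow transfer, IX: every group of order `8p` with an element of order `4p` — `μ(G, c) = φ₂(G, c)` for EVERY central involution

`p` an odd prime, `|G| = 8p`, `u ∈ G` of order `4p` (a cyclic subgroup `C = ⟨u⟩` of index two), `c` a central involution.  Gen 50ʼs successor menu
(§5 of `HOME/pub-hodgecm2-b23/TWO-GROUPS-CAPSTONE.md`) asked for this assembly; with part VII only the NON-abelian Sylow `2`-subgroups need the old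
shape laws.  `t := uᵖ` (order `4`, `t² = u^{2p}`), `z := u⁴` (order `p`); a Sylow `2`-subgroup `P ∋ t` meets `C` in `⟨t⟩` and contains some
`y ∉ C`; `y t y⁻¹ ∈ {t, t⁻¹}` and `y z y⁻¹ ∈ {z, z⁻¹}` (§1–§2).
* `c ∉ C` ⟹ `C` is a complement (gen 40).
* `y t y⁻¹ = t` ⟹ `P = ⟨t⟩ ∪ y⟨t⟩` is ABELIAN ⟹ part VII (`ℤ/8`, `ℤ/4 × ℤ/2`).
* `y t y⁻¹ = t⁻¹`, `y z y⁻¹ = z⁻¹` ⟹ `y u y⁻¹ = u⁻¹`: INVERSION TYPE `D_{8p} ∪ Q_{8p}` (gen 50ʼs `IndexTwoCyclic.isLeast_card_gfaces_generate_fibreTwo_of_inverting`).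
* `y t y⁻¹ = t⁻¹`, `y z y⁻¹ = z` ⟹ `z` is central, `y² ∈ {1, c}` and `(ι(a,b) = cᵃ zᵇ, y, t)` is an OCTIC PRODUCT DATUM over `ℤ/p` (`G ≅ D₄ × ℤ/p` or
  `Q₈ × ℤ/p`; exhaustion by gen 45ʼs `OcticProduct.exhaust_of_card`) ⟹ gen 45ʼs `OcticProduct.isLeast_card_gfaces_generate_cyclic`.
Hence **`isLeast_card_gfaces_generate_fibreTwo_of_card_eq_eight_mul_prime`**: for every group of order `8p` (`p` an odd prime) with an element of
order `4p` and every central involution `c ≠ 1`, `μ(G, c) = φ₂(G, c)`.  With part VII the order-`8p` census is complete EXCEPT for non-abelian Sylow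
`2`-subgroups without an element of order `4p` (`X_p = ℤ/p ⋊ D₄` with Klein kernel; `SL(2,3)` at `p = 3`).
All [folklore] bookkeeping over [Pohlmann1968, Thm 1] in the reading of [Milne1999, Prop. 2.1].

## References
* [Pohlmann1968] H. Pohlmann, Algebraic cycles on abelian varieties of complex multiplication type, Ann. of Math. 88 (1968), Thm 1.
* [Milne1999] J. S. Milne, Lefschetz motives and the Tate conjecture, Compositio Math. 117 (1999), Prop. 2.1, p. 54.
-/

namespace Summit.HodgeConjecture.CorCM.Census.SylowTransfer

open Finset
open Summit.HodgeConjecture.CorCM.Prior.AllgGroup.RfwfAllgGroup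
open Summit.HodgeConjecture.CorCM.Census.BlockParity
open Summit.HodgeConjecture.CorCM.Census.Coinvariant

noncomputable section

section Group

variable {G : Type*} [Group G]

/-! ## §1 Cyclic bookkeeping -/

/-- In `⟨u⟩` with `ord u = n·d`, an element whose order divides `d` lies in `⟨uⁿ⟩`. [folklore] -/
theorem mem_zpowers_pow_of_orderOf_dvd [Finite G] {u x : G} {n d : ℕ} (hord : orderOf u = n * d) (hd : 0 < d) (hx : x ∈ Subgroup.zpowers u)
    (hxd : orderOf x ∣ d) : x ∈ Subgroup.zpowers (u ^ n) := by
  obtain ⟨i, -, rfl⟩ := IndexTwoCyclic.exists_pow_eq_of_mem_zpowers hx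
  have h1 : u ^ (i * d) = 1 := by rw [pow_mul, ← orderOf_dvd_iff_pow_eq_one.mp hxd]
  have h2 : n * d ∣ i * d := hord ▸ orderOf_dvd_of_pow_eq_one h1
  obtain ⟨j, hj⟩ := Nat.dvd_of_mul_dvd_mul_right hd h2
  exact Subgroup.mem_zpowers_iff.mpr ⟨(j : ℤ), by rw [zpow_natCast, ← pow_mul, ← hj]⟩

/-- The elements of order `4` of a cyclic group `⟨t⟩` of order `4` are `t` and `t⁻¹`. [folklore] -/
theorem eq_or_eq_inv_of_orderOf_four [Finite G] {t x : G} (ht : orderOf t = 4) (hx : x ∈ Subgroup.zpowers t) (hx4 : orderOf x = 4) :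
    x = t ∨ x = t⁻¹ := by
  obtain ⟨i, hi, rfl⟩ := IndexTwoCyclic.exists_pow_eq_of_mem_zpowers hx
  rw [ht] at hi
  interval_cases i
  · rw [pow_zero, orderOf_one] at hx4; omega
  · left; rw [pow_one]
  · exfalso
    have h : (t ^ 2) ^ 2 = 1 := by rw [← pow_mul, show 2 * 2 = orderOf t by rw [ht], pow_orderOf_eq_one]
    have := orderOf_dvd_of_pow_eq_one h
    rw [hx4] at this
    omega
  · right
    rw [eq_inv_iff_mul_eq_one, ← pow_succ, show 3 + 1 = orderOf t by rw [ht], pow_orderOf_eq_one]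

/-- The elements of `⟨t⟩` (`ord t = 4`) commuting with an element `y` that inverts `t` are `1` and `t²`: an element `s ∈ ⟨t⟩` with
`y s y⁻¹ = s` and `y t y⁻¹ = t⁻¹` is `1` or `t²`. [folklore] -/
theorem eq_one_or_eq_sq_of_inverted [Finite G] {t y s : G} (ht : orderOf t = 4) (hyt : y * t * y⁻¹ = t⁻¹) (hs : s ∈ Subgroup.zpowers t)
    (hys : y * s * y⁻¹ = s) : s = 1 ∨ s = t ^ 2 := by
  obtain ⟨i, hi, rfl⟩ := IndexTwoCyclic.exists_pow_eq_of_mem_zpowers hs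
  rw [ht] at hi
  have hconj : y * t ^ i * y⁻¹ = t⁻¹ ^ i := by rw [← MulAut.conj_apply, map_pow, MulAut.conj_apply, hyt]
  rw [hconj, inv_pow, inv_eq_iff_mul_eq_one, ← pow_add, ← orderOf_dvd_iff_pow_eq_one, ht] at hys
  interval_cases i
  · left; rw [pow_zero]
  · exfalso; omega
  · right; rfl
  · exfalso; omega

/-- A square root of `1` in `ℤ/p` (`p` prime) is `±1`: `z^{s²} = z` with `ord z = p` forces `zˢ = z` or `zˢ = z⁻¹`. [folklore] -/
theorem pow_eq_or_eq_inv_of_sq {z : G} {p : ℕ} (hp : p.Prime) (hz : orderOf z = p) {s : ℕ} (h : (z ^ s) ^ s = z) :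
    z ^ s = z ∨ z ^ s = z⁻¹ := by
  haveI : Fact p.Prime := ⟨hp⟩
  have hsq : ((s : ZMod p)) * (s : ZMod p) = 1 := by
    rw [← pow_mul] at h
    have h' : s * s % p = 1 % p := by
      have := pow_inj_mod.mp (h.trans (pow_one z).symm)
      rwa [hz] at this
    rw [← Nat.cast_mul, ← Nat.cast_one, ZMod.natCast_eq_natCast_iff', h']
  rcases mul_self_eq_one_iff.mp hsq with h1 | h1
  · left
    have h1' : s % p = 1 := by
      have := (ZMod.natCast_eq_natCast_iff' s 1 p).mp (by rw [Nat.cast_one]; exact h1)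
      rwa [Nat.mod_eq_of_lt hp.one_lt] at this
    rw [← pow_mod_orderOf, hz, h1', pow_one]
  · right
    rw [eq_inv_iff_mul_eq_one, ← pow_succ, ← orderOf_dvd_iff_pow_eq_one, hz, ← ZMod.natCast_eq_zero_iff, Nat.cast_succ, h1, neg_add_cancel]

/-! ## §2 The element of order `4p`: `t = uᵖ`, `z = u⁴`, a Sylow `2`-subgroup through `t` -/

/-- `ord uᵖ = 4` and `ord u⁴ = p` for `ord u = 4p`, `p` odd. [folklore] -/
theorem orderOf_pow_p_and_four [Finite G] {u : G} {p : ℕ} (hp : p.Prime) (hp2 : p ≠ 2) (hord : orderOf u = 4 * p) :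
    orderOf (u ^ p) = 4 ∧ orderOf (u ^ 4) = p := by
  have hodd : Odd p := hp.odd_of_ne_two hp2
  have hcop : Nat.Coprime 4 p := by
    rw [show (4 : ℕ) = 2 ^ 2 by norm_num]
    exact Nat.Coprime.pow_left _ (Nat.coprime_two_left.mpr hodd)
  constructor
  · rw [orderOf_pow' u hp.ne_zero, hord, Nat.gcd_mul_left_left, Nat.mul_div_cancel _ hp.pos]
  · rw [orderOf_pow' u (by norm_num), hord, Nat.gcd_mul_right_left, Nat.mul_div_cancel_left _ (by norm_num)]

end Group

variable {G : Type*} [Group G] [Fintype G] [DecidableEq G]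

/-! ## §3 The law -/

/-- **EVERY GROUP OF ORDER `8p` (`p` AN ODD PRIME) WITH AN ELEMENT OF ORDER `4p`, EVERY CENTRAL INVOLUTION: `μ(G, c) = φ₂(G, c)`.** [folklore] -/
theorem isLeast_card_gfaces_generate_fibreTwo_of_card_eq_eight_mul_prime (c : G) {p : ℕ} (hp : p.Prime) (hp2 : p ≠ 2)
    (hG : Fintype.card G = 8 * p) (u : G) (hord : orderOf u = 4 * p) (hc2 : c * c = 1) (hc1 : c ≠ 1) (hcen : ∀ y : G, y * c = c * y) :
    IsLeast {n : ℕ | ∃ S : Finset (CMF G c →₀ ℤ), (↑S ⊆ gfaceSet G c hc2) ∧ S.card = n ∧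
      hodgeSpan c hc2 ≤ Submodule.span ℤ (pairSet c) ⊔ Submodule.span ℤ (translates c S)} (fibreTwo c hc2) := by
  haveI : Fact (Nat.Prime 2) := ⟨Nat.prime_two⟩
  haveI : Fact p.Prime := ⟨hp⟩
  have hodd : Odd p := hp.odd_of_ne_two hp2
  haveI : NeZero p := ⟨hp.ne_zero⟩
  have h3 : 3 ≤ p := by
    have := hp.two_le
    omega
  -- the cyclic subgroup of index two
  set C := Subgroup.zpowers u with hC
  have hCcard : Nat.card C = 4 * p := by rw [hC, Nat.card_zpowers, hord]
  have hidx : C.index = 2 := by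
    have h := C.card_mul_index
    rw [hCcard, Nat.card_eq_fintype_card, hG] at h
    have : 4 * p * C.index = 4 * p * 2 := by rw [h]; ring
    exact Nat.eq_of_mul_eq_mul_left (by omega) this
  haveI hCn : C.Normal := Subgroup.normal_of_index_eq_two hidx
  -- `c ∉ C`: complemented
  by_cases hcC : c ∈ C
  swap
  · exact ComplementFaces.isLeast_card_gfaces_generate_fibreTwo_of_cpl c (cpl_of_index_two c hidx hcC) hc2 hc1 hcen
  -- `c ∈ C`: `c = u^{2p}`; `t = u^p`, `z = u^4`
  have hcu : c = u ^ (2 * p) := IndexTwoCyclic.eq_pow_of_mem_zpowers_of_mul_self (by rw [hord]; ring) hcC hc2 hc1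
  obtain ⟨ht4, hzp⟩ := orderOf_pow_p_and_four hp hp2 hord
  set t := u ^ p with htdef
  set z := u ^ 4 with hzdef
  have htt : t * t = c := by rw [htdef, ← pow_add, hcu, two_mul]
  have htC : t ∈ C := Subgroup.pow_mem _ (Subgroup.mem_zpowers u) _
  have hzC : z ∈ C := Subgroup.pow_mem _ (Subgroup.mem_zpowers u) _
  have hCcomm : ∀ a ∈ C, ∀ b ∈ C, a * b = b * a := fun a ha b hb => by
    obtain ⟨i, rfl⟩ := Subgroup.mem_zpowers_iff.mp ha
    obtain ⟨j, rfl⟩ := Subgroup.mem_zpowers_iff.mp hb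
    exact (Commute.zpow_zpow_self u i j).eq
  -- a Sylow `2`-subgroup through `t`
  obtain ⟨P, hP⟩ := (IsPGroup.of_card (p := 2) (n := 2) (by rw [Nat.card_zpowers, ht4]; norm_num) :
    IsPGroup 2 (Subgroup.zpowers t)).exists_le_sylow
  have htP : t ∈ (P : Subgroup G) := hP (Subgroup.mem_zpowers t)
  obtain ⟨hP8, hPidx⟩ := card_sylow_eq_eight P hG hodd
  -- `P ∩ C ⊆ ⟨t⟩`
  have hPC : ∀ a ∈ (P : Subgroup G), a ∈ C → a ∈ Subgroup.zpowers t := fun a haP haC => by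
    refine mem_zpowers_pow_of_orderOf_dvd (n := p) (d := 4) (by rw [hord, mul_comm]) (by norm_num) haC ?_
    have h8 : orderOf a ∣ 8 := hP8 ▸ (P : Subgroup G).orderOf_dvd_natCard haP
    have h4p : orderOf a ∣ 4 * p := hCcard ▸ C.orderOf_dvd_natCard haC
    have := Nat.dvd_gcd h8 h4p
    rwa [show Nat.gcd 8 (4 * p) = 4 by
      rw [show (8 : ℕ) = 4 * 2 by norm_num, Nat.gcd_mul_left, (Nat.coprime_two_left.mpr hodd).gcd_eq_one, mul_one]] at this
  -- some `y ∈ P` outside `C`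
  obtain ⟨y, hyP, hyC⟩ : ∃ y ∈ (P : Subgroup G), y ∉ C := by
    by_contra h
    push Not at h
    have hle : (P : Subgroup G) ≤ Subgroup.zpowers t := fun a ha => hPC a ha (h a ha)
    have := Subgroup.card_le_of_le hle
    rw [hP8, Nat.card_zpowers, ht4] at this
    omega
  -- `y t y⁻¹ ∈ {t, t⁻¹}`
  have hyty : y * t * y⁻¹ = t ∨ y * t * y⁻¹ = t⁻¹ := by
    refine eq_or_eq_inv_of_orderOf_four ht4 (hPC _ (mul_mem (mul_mem hyP htP) (inv_mem hyP)) (hCn.conj_mem t htC y)) ?_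
    rw [← MulAut.conj_apply, MulEquiv.orderOf_eq, ht4]
  rcases hyty with hyt | hyt
  · -- CASE A: `P` is abelian
    have hsplit : ∀ a ∈ (P : Subgroup G), a ∈ Subgroup.zpowers t ∨ ∃ s ∈ Subgroup.zpowers t, a = y * s := fun a ha => by
      by_cases haC : a ∈ C
      · exact Or.inl (hPC a ha haC)
      · refine Or.inr ⟨y⁻¹ * a, hPC _ (mul_mem (inv_mem hyP) ha) ?_, by rw [mul_inv_cancel_left]⟩
        exact (Subgroup.mul_mem_iff_of_index_two hidx).mpr ⟨fun h => absurd (inv_mem_iff.mp h) hyC, fun h => absurd h haC⟩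
    have hyt' : Commute y t := mul_inv_eq_iff_eq_mul.mp hyt
    have hct : ∀ a ∈ (P : Subgroup G), Commute a t ∧ Commute a y := fun a ha => by
      rcases hsplit a ha with h | ⟨s, hs, rfl⟩
      · obtain ⟨i, rfl⟩ := Subgroup.mem_zpowers_iff.mp h
        exact ⟨Commute.zpow_left (Commute.refl t) i, (hyt'.symm).zpow_left i⟩
      · obtain ⟨i, rfl⟩ := Subgroup.mem_zpowers_iff.mp hs
        exact ⟨(hyt'.mul_left (Commute.zpow_left (Commute.refl t) i)),
          ((Commute.refl y).mul_left ((hyt'.symm).zpow_left i))⟩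
    have hcomm : ∀ a ∈ (P : Subgroup G), ∀ b ∈ (P : Subgroup G), a * b = b * a := fun a ha b hb => by
      obtain ⟨hat, hay⟩ := hct a ha
      rcases hsplit b hb with h | ⟨s, hs, rfl⟩
      · obtain ⟨i, rfl⟩ := Subgroup.mem_zpowers_iff.mp h
        exact (hat.zpow_right i).eq
      · obtain ⟨i, rfl⟩ := Subgroup.mem_zpowers_iff.mp hs
        exact (hay.mul_right (hat.zpow_right i)).eq
    exact isLeast_card_gfaces_generate_fibreTwo_of_card_eq_eight_mul_odd_comm c hG hodd hp.one_lt.ne' P hcomm hc2 hc1 hcen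
  · -- CASE B: `y` inverts `t`; the action on `z`
    have hyzC : y * z * y⁻¹ ∈ Subgroup.zpowers z := by
      refine mem_zpowers_pow_of_orderOf_dvd (n := 4) (d := p) hord hp.pos (hCn.conj_mem z hzC y) ?_
      rw [← MulAut.conj_apply, MulEquiv.orderOf_eq, hzp]
    obtain ⟨s, -, hs⟩ := IndexTwoCyclic.exists_pow_eq_of_mem_zpowers hyzC
    have hyyC : y * y ∈ C := Subgroup.mul_self_mem_of_index_two hidx y
    have hss : (z ^ s) ^ s = z := by
      -- `z = y² z y⁻² = (y z y⁻¹)^s`-conjugate … = z^{s²}`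
      have h1 : y * z ^ s * y⁻¹ = (z ^ s) ^ s := by
        rw [← MulAut.conj_apply, map_pow, MulAut.conj_apply, hs]
      have h2 : y * (y * z * y⁻¹) * y⁻¹ = z := by
        rw [show y * (y * z * y⁻¹) * y⁻¹ = (y * y) * z * (y * y)⁻¹ by group]
        rw [mul_inv_eq_iff_eq_mul, hCcomm _ hyyC z hzC]
      rw [← hs] at h2
      rw [← h1]
      exact h2
    rcases pow_eq_or_eq_inv_of_sq hp hzp hss with hzs | hzs
    · -- CASE B(b): `z` central on `⟨C, y⟩ = G`, octic product
      rw [hzs] at hs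
      -- `y² ∈ {1, c}`
      have hyz : Commute y z := mul_inv_eq_iff_eq_mul.mp hs.symm
      have hyy : y * y = 1 ∨ y * y = t ^ 2 :=
        eq_one_or_eq_sq_of_inverted ht4 hyt (hPC _ (mul_mem hyP hyP) hyyC) (by group)
      obtain ⟨e, he2, hye⟩ : ∃ e : ℕ, e < 2 ∧ y * y = c ^ e := by
        rcases hyy with h | h
        · exact ⟨0, by norm_num, by rw [h, pow_zero]⟩
        · exact ⟨1, by norm_num, by rw [h, pow_one, pow_two, htt]⟩
      have hordc : orderOf c = 2 := orderOf_eq_prime (by rw [pow_two, hc2]) hc1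
      have hcz : Commute c z := (hcen z).symm
      have htz : Commute t z := Commute.pow_pow_self u p 4
      -- the embedding `ι (a, b) = cᵃ zᵇ`
      set ι : ZMod 2 × ZMod p → G := fun ab => c ^ ab.1.val * z ^ ab.2.val with hι
      have hcpow : ∀ a b : ZMod 2, c ^ (a + b).val = c ^ a.val * c ^ b.val := fun a b => by
        rw [← pow_add, pow_inj_mod, hordc, ZMod.val_add, Nat.mod_mod]
      have hzpow : ∀ a b : ZMod p, z ^ (a + b).val = z ^ a.val * z ^ b.val := fun a b => by
        rw [← pow_add, pow_inj_mod, hzp, ZMod.val_add, Nat.mod_mod]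
      have hadd : ∀ a b, ι (a + b) = ι a * ι b := fun a b => by
        simp only [hι, Prod.fst_add, Prod.snd_add]
        rw [hcpow, hzpow, (hcz.pow_pow b.1.val a.2.val).mul_mul_mul_comm]
      have hιC : ∀ a, ι a ∈ C := fun a => mul_mem (Subgroup.pow_mem _ hcC _) (Subgroup.pow_mem _ hzC _)
      have hinj : Function.Injective ι := by
        rintro ⟨a1, a2⟩ ⟨b1, b2⟩ h
        simp only [hι] at h
        have hg : (c ^ b1.val)⁻¹ * c ^ a1.val = z ^ b2.val * (z ^ a2.val)⁻¹ := by
          rw [inv_mul_eq_iff_eq_mul, ← mul_assoc, eq_mul_inv_iff_mul_eq]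
          exact h
        have hg1 : (c ^ b1.val)⁻¹ * c ^ a1.val = 1 := by
          have h2 : orderOf ((c ^ b1.val)⁻¹ * c ^ a1.val) ∣ 2 := by
            have hmem : (c ^ b1.val)⁻¹ * c ^ a1.val ∈ Subgroup.zpowers c :=
              mul_mem (inv_mem (Subgroup.pow_mem _ (Subgroup.mem_zpowers c) b1.val))
                (Subgroup.pow_mem _ (Subgroup.mem_zpowers c) a1.val)
            have := (Subgroup.zpowers c).orderOf_dvd_natCard hmem
            rwa [Nat.card_zpowers, hordc] at this
          have hp' : orderOf ((c ^ b1.val)⁻¹ * c ^ a1.val) ∣ p := by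
            rw [hg]
            have hmem : z ^ b2.val * (z ^ a2.val)⁻¹ ∈ Subgroup.zpowers z :=
              mul_mem (Subgroup.pow_mem _ (Subgroup.mem_zpowers z) b2.val)
                (inv_mem (Subgroup.pow_mem _ (Subgroup.mem_zpowers z) a2.val))
            have := (Subgroup.zpowers z).orderOf_dvd_natCard hmem
            rwa [Nat.card_zpowers, hzp] at this
          have h1 : orderOf ((c ^ b1.val)⁻¹ * c ^ a1.val) ∣ 1 := by
            rw [← (Nat.coprime_two_left.mpr hodd).gcd_eq_one]
            exact Nat.dvd_gcd h2 hp'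
          exact orderOf_eq_one_iff.mp (Nat.dvd_one.mp h1)
        have hc' : c ^ b1.val = c ^ a1.val := inv_mul_eq_one.mp hg1
        have hz' : z ^ b2.val = z ^ a2.val := by
          rw [hg1] at hg
          exact mul_inv_eq_one.mp hg.symm
        have e1 : b1.val = a1.val := by
          have := pow_inj_mod.mp hc'
          rwa [hordc, Nat.mod_eq_of_lt (ZMod.val_lt b1), Nat.mod_eq_of_lt (ZMod.val_lt a1)] at this
        have e2 : b2.val = a2.val := by
          have := pow_inj_mod.mp hz'
          rwa [hzp, Nat.mod_eq_of_lt (ZMod.val_lt b2), Nat.mod_eq_of_lt (ZMod.val_lt a2)] at this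
        exact Prod.ext (ZMod.val_injective _ e1.symm) (ZMod.val_injective _ e2.symm)
      have hy_mul : ∀ a, y * ι a = ι a * y := fun a =>
        ((Commute.pow_right (hcen y : Commute y c) a.1.val).mul_right (hyz.pow_right a.2.val)).eq
      have hyy' : y * y = ι (((e : ℕ) : ZMod 2), 0) := by
        simp only [hι, ZMod.val_zero, pow_zero, mul_one]
        rw [ZMod.val_natCast, Nat.mod_eq_of_lt he2, hye]
      have ht_mul : ∀ a, t * ι a = ι a * t := fun a =>
        ((Commute.pow_right (hcen t : Commute t c) a.1.val).mul_right (htz.pow_right a.2.val)).eq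
      have hy_t : y * t = c * t * y := by
        have h1 : y * t = t⁻¹ * y := mul_inv_eq_iff_eq_mul.mp hyt
        have h2 : t⁻¹ = c * t := inv_eq_of_mul_eq_one_right (by rw [← mul_assoc, hcen t, mul_assoc, htt, hc2])
        rw [h1, h2]
      have hy_ne : ∀ a, y ≠ ι a := fun a h => hyC (h ▸ hιC a)
      have ht_ne : ∀ a, t ≠ ι a := fun a h => by
        have h' : u ^ p = u ^ (2 * p * a.1.val + 4 * a.2.val) := by
          rw [← htdef, h]
          simp only [hι]
          rw [hzdef, hcu, ← pow_mul, ← pow_mul, ← pow_add]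
        have hm := pow_inj_mod.mp h'
        rw [hord, Nat.mod_eq_of_lt (show p < 4 * p by omega)] at hm
        have h2 : 2 ∣ (2 * p * a.1.val + 4 * a.2.val) % (4 * p) :=
          (Nat.dvd_mod_iff (⟨2 * p, by ring⟩ : 2 ∣ 4 * p)).mpr ⟨p * a.1.val + 2 * a.2.val, by ring⟩
        rw [← hm] at h2
        exact hodd.not_two_dvd_nat h2
      have ht_ne' : ∀ a, t ≠ y * ι a := fun a h => hyC (by
        rw [show y = t * (ι a)⁻¹ by rw [eq_mul_inv_iff_mul_eq]; exact h.symm]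
        exact mul_mem htC (inv_mem (hιC a)))
      have hcardA : Fintype.card G = 8 * Fintype.card (ZMod p) := by rw [ZMod.card, hG]
      have hexh := OcticProduct.exhaust_of_card (ζ := ((e : ℕ) : ZMod 2)) ι y t hadd hinj hy_mul hyy' hy_ne ht_ne ht_ne' hcardA
      have hmap_c : ι (1, 0) = c := by
        simp only [hι, ZMod.val_zero, pow_zero, mul_one]
        rw [ZMod.val_one, pow_one]
      let D : OcticProduct.Datum G c (ZMod p) ((e : ℕ) : ZMod 2) :=
        { ι := ι, y := y, t := t, map_add := hadd, map_c := hmap_c, y_mul := hy_mul, y_mul_y := hyy', t_mul := ht_mul,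
          t_mul_t := htt, y_mul_t := hy_t, inj := hinj, y_ne := hy_ne, t_ne := ht_ne, t_ne' := ht_ne', exhaust := hexh }
      exact OcticProduct.isLeast_card_gfaces_generate_cyclic D hc2 hodd h3
    · -- CASE B(a): `y` inverts `z`, hence `u`: inversion type
      rw [hzs] at hs
      obtain ⟨r, -, hr⟩ := IndexTwoCyclic.exists_pow_eq_of_mem_zpowers (hCn.conj_mem u (Subgroup.mem_zpowers u) y)
      have hconj : ∀ n : ℕ, y * u ^ n * y⁻¹ = (u ^ r) ^ n := fun n => by rw [← MulAut.conj_apply, map_pow, MulAut.conj_apply, hr]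
      have h4 : 4 ∣ r + 1 := by
        have h := hconj p
        rw [← htdef, hyt, ← pow_mul, mul_comm, pow_mul, ← htdef, inv_eq_iff_mul_eq_one, ← pow_succ', ← orderOf_dvd_iff_pow_eq_one, ht4] at h
        exact h
      have hp' : p ∣ r + 1 := by
        have h := hconj 4
        rw [← hzdef, ← hs, ← pow_mul, mul_comm, pow_mul, ← hzdef, inv_eq_iff_mul_eq_one, ← pow_succ', ← orderOf_dvd_iff_pow_eq_one, hzp] at h
        exact h
      have hcop : Nat.Coprime 4 p := by
        rw [show (4 : ℕ) = 2 ^ 2 by norm_num]; exact Nat.Coprime.pow_left _ (Nat.coprime_two_left.mpr hodd)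
      have hyu : y * u * y⁻¹ = u⁻¹ := by
        rw [← hr, eq_inv_iff_mul_eq_one, ← pow_succ, ← orderOf_dvd_iff_pow_eq_one, hord]
        exact hcop.mul_dvd_of_dvd_of_dvd h4 hp'
      exact IndexTwoCyclic.isLeast_card_gfaces_generate_fibreTwo_of_inverting hc2 hc1 u y (n := 2 * p) (by omega)
        (by rw [hcu]) (by rw [hord]; ring) hidx hyC hyu

end

end Summit.HodgeConjecture.CorCM.Census.SylowTransfer
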